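import Summits.MatrixMultiplication.MatrixMultiplication.Theorems.MarginalColumnsSecondColumnDominatesStubColumnSlope
import Summits.MatrixMultiplication.MatrixMultiplication.Theorems.SecondColumnDominates.Negative.LoadBearing

/-!
# `SecondColumnDominates` — stub `stub_floorOfDominates` (line `Sketch`, crux stmt-MatrixMultiplication-16310):
# D forces the second-column floor `n² + 2n − 1 ≤ R̲⟨n,n,2⟩` (necessity half; refuter probe W1b as a tree lemma)

Route `MatrixMultiplication/MarginalColumns`, crux D = `SecondColumnDominates`
(`∀ n w ≥ 1, T n (w+1) + T n 1 ≤ T n w + T n 2` with `T n w := algBorderRank (matMulTensor ℂ n n w)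
= R̲⟨n,n,w⟩`, the column tower of the square format), line `Sketch` (koszul-pivot-split:
D ⇐ square column step ∧ second-column floor). This file proves that the floor half of the line is
ZERO-RISK for the crux: D itself implies it,

  `stub_floorOfDominates : SecondColumnDominates → ∀ n ≥ 1, n·n + 2·n ≤ T n 2 + 1`.

## Proof

* `tower_of_dominates` — from D by induction on `w` (as in the route's `closes`, step 1), with
  `T n 1 = n·n` (`Negative.algBorderRank_matMulTensor_sq_one`), subtraction-free:
  `T n (w+1) + w·n² ≤ n² + w·T n 2` for every `w`.
* `stub_floorOfDominates` — if `T n 2 ≤ n² + 2n − 2`, the tower bound at `w = n²` gives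
  `T n (n²+1) ≤ n² + n²(2n − 2) = 2n³ − n²`, while the rectangular Landsberg–Ottaviani column slope
  (`stub_columnSlope`, landed: `2·n·w ≤ T n w + w`, i.e. `(2n−1)·w ≤ R̲⟨n,n,w⟩`, Landsberg 2017
  Thm. 2.5.2.6) gives `T n (n²+1) ≥ (2n−1)(n²+1) = 2n³ − n² + 2n − 1`; so `2n ≤ 1`, absurd for `n ≥ 1`.

All sorry-free, standard axioms. Reference: J. M. Landsberg, *Geometry and Complexity Theory*, CUP
2017, §2.5.2, Thm. 2.5.2.6 [LandsbergGCT2017].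
-/

-- `MatrixMultiplication.MatrixMultiplication` (summit = problem) is the tree's layout, not a typo.
set_option linter.dupNamespace false

noncomputable section

namespace Summit.MatrixMultiplication.MatrixMultiplication.Theorems.SecondColumnDominates

open Literature.Computability.AlgebraicComplexity
open Summit.MatrixMultiplication.MatrixMultiplication.Theses.MarginalColumns

/-- **The tower bound from D (subtraction-free).** If the second column dominates then, for `n ≥ 1`
and every `w`, `R̲⟨n,n,w+1⟩ + w·n² ≤ n² + w·R̲⟨n,n,2⟩`, i.e. `T n (w+1) ≤ n² + w·(T n 2 − n²)`:
induction on `w`, each step adding the cell `(n, w+1)` of D and using `T n 1 = n·n`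
(`Negative.algBorderRank_matMulTensor_sq_one`). The route's `closes`, step 1, started at `w = 0`.
[folklore] -/
theorem tower_of_dominates (hD : SecondColumnDominates) (n : ℕ) (hn : 1 ≤ n) :
    ∀ w : ℕ, algBorderRank (matMulTensor ℂ n n (w + 1)) + w * (n * n) ≤
      n * n + w * algBorderRank (matMulTensor ℂ n n 2) := by
  have h1 : algBorderRank (matMulTensor ℂ n n 1) = n * n :=
    Negative.algBorderRank_matMulTensor_sq_one n
  intro w
  induction w with
  | zero => simp [h1]
  | succ w ih =>
    have hd := hD n (w + 1) hn (Nat.succ_pos w)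
    rw [h1] at hd
    linarith [ih, hd]

/-- **Stub `stub_floorOfDominates` of line `Sketch` (crux `SecondColumnDominates`), registered
signature: D forces the second-column floor.** `SecondColumnDominates → ∀ n ≥ 1, n·n + 2·n ≤ R̲⟨n,n,2⟩ + 1`
(i.e. `R̲⟨n,n,2⟩ ≥ n² + 2n − 1`, the first marginal of the column tower is at least the Koszul slope
`2n − 1`): otherwise the tower bound `tower_of_dominates` at `w = n²` contradicts the rectangular
Landsberg–Ottaviani column slope `stub_columnSlope` (`(2n−1)(n²+1) ≤ R̲⟨n,n,n²+1⟩ ≤ 2n³ − n²`).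
[cite: LandsbergGCT2017, §2.5.2, Thm. 2.5.2.6] -/
theorem stub_floorOfDominates :
    Summit.MatrixMultiplication.MatrixMultiplication.Theses.MarginalColumns.SecondColumnDominates →
      ∀ n : ℕ, 1 ≤ n →
        n * n + 2 * n ≤
          Literature.Computability.AlgebraicComplexity.algBorderRank
            (Literature.Computability.AlgebraicComplexity.matMulTensor ℂ n n 2) + 1 := by
  intro hD n hn
  by_contra hlt
  push Not at hlt
  have ht := tower_of_dominates hD n hn (n * n)
  have hs := stub_columnSlope n (n * n + 1) hn
  have key : n * n * (algBorderRank (matMulTensor ℂ n n 2) + 2) ≤ n * n * (n * n + 2 * n) :=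
    Nat.mul_le_mul_left _ (by omega)
  nlinarith [ht, hs, key, hn]

end Summit.MatrixMultiplication.MatrixMultiplication.Theorems.SecondColumnDominates

end
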